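import Summits.Ventures.PercRepro.RankLevelSetColoopDevice
import Summits.Ventures.PercRepro.RankLevelSetCoreSixColoopFree
import Summits.Ventures.PercRepro.RankLevelSetDeleteColoops
import Summits.Ventures.PercRepro.S1LadderQ
import Summits.Ventures.PercRepro.S2LPColoops
import Summits.Ventures.PercRepro.S1RowNineAll
import Summits.Ventures.PercRepro.S1RowSevenAll
import Summits.Ventures.PercRepro.RankLevelSetPlaneTenPrime

/-!
# PercRepro — THE COLOOP DEVICE WITH THE LOSSY LADDER AT LEVEL `7`, GENERIC IN THE ROW AND THE CORANK — THE `e`-FREE FORM (p7 g24, S4 feeder;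
p9 owns S4 — no window claim)

The same device as `c025_core_seven_of_cells` (S4SevenDevice), with the natural-cell hypothesis ALSO given the `e`-freeness of the coloop-free core
(`delete_coloops_core_data` provides it): a cell that needs p4's `f(7) = 79` (`ncard_le_seventynine_of_eRk_le_seven_of_free`, e.g. `(13, 74)` =
`S3LP.s7lp_13_87_of_flat7_79`) is admitted as a layer. Plain cells ignore the extra hypothesis.

**`c025_core_seven_of_cells_free`**. Nothing else is claimed.
Axioms: standard.
-/

open scoped Matroid

namespace PercRepro

namespace ThmN

open Set Matroid

variable {α : Type}

/-- **THE COLOOP DEVICE AT LEVEL `7`, GENERIC, `e`-FREE FORM**: as `c025_core_seven_of_cells`, the natural cell `(p − k, d)` now assumed only on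
coloop-free `e`-FREE cores (the `e`-freeness is an extra antecedent, available to cells that need `f(7) = 79`). -/
theorem c025_core_seven_of_cells_free (M : Matroid α) [M.Finite] (p d K : ℕ)
    (hK : 8 + K ≤ p)
    (hret : phiK p 7 ≤ 2 * ((2 : ℚ) ^ K - 1))
    (hcell : ∀ k < K, ∃ c : ℚ, phiK p 7 ≤ 2 ^ k * c + 2 * ((2 : ℚ) ^ k - 1) ∧
      ∀ (N : Matroid α) [N.Finite], N.eRank = ((p - k : ℕ) : ℕ∞) → N.E.ncard = p - k + d →
      N.coloops = ∅ → (∀ e ∈ N.E, ∃ A ⊆ N.E \ {e}, e ∉ N.closure A ∧ e ∉ N.closure ((N.E \ {e}) \ A)) →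
      (∀ e ∈ N.E, ∀ f ∈ N.E, e ≠ f → N.eRk {e, f} = 2) →
      (∀ L ⊆ N.E, N.eRk L = 2 → L.ncard ≤ 3) → (∀ P ⊆ N.E, N.eRk P ≤ 3 → P.ncard ≤ 6) →
      (∀ X ⊆ N.E, N.eRk X ≤ 4 → X.ncard ≤ 10) → (∀ X ⊆ N.E, N.eRk X ≤ 5 → X.ncard ≤ 19) →
      c * (Matroid.topCount N (p - k) 7 : ℚ) ≤ (Matroid.midCount N (p - k) 7 : ℚ))
    (hR : M.eRank = (p : ℕ∞)) (hn : M.E.ncard = p + d)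
    (hfree : ∀ e ∈ M.E, ∃ A ⊆ M.E \ {e}, e ∉ M.closure A ∧ e ∉ M.closure ((M.E \ {e}) \ A)) :
    RLS M p 7 := by
  classical
  have hfin : M.coloops.Finite := M.ground_finite.subset (Matroid.coloops_subset_ground M)
  set Kc : Finset α := hfin.toFinset with hKdef
  have hKset : (Kc : Set α) = M.coloops := by rw [hKdef, Set.Finite.coe_toFinset]
  have hKc : ∀ e ∈ Kc, M.IsColoop e := fun e he => by
    rw [hKdef, Set.Finite.mem_toFinset] at he
    exact he
  have hR' : M.eRank = ((p : ℕ) : ℕ∞) := hR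
  have hKcard : Kc.card = M.coloops.ncard := by rw [← hKset, Set.ncard_coe_finset]
  obtain ⟨hn0, hR0, hfree0, -⟩ := delete_coloops_core_data M Kc hKc hR' hn hfree
  by_cases hge : K ≤ Kc.card
  · -- `K` coloops or more: the lossy ladder retires the cell
    have hpK : p - K + K = p := by omega
    have hmain := S1.rls_of_coloops_lossy_q M (p := p - K) (q := 7) (c := K)
      (by rw [hR', hpK]) (by omega) (by norm_num) (by omega) (by rw [hpK]; exact hret)
    rwa [hpK] at hmain
  · rw [not_le] at hge
    -- `k < K` coloops: the natural cell `(p − k, d)` on the coloop-free core, lifted by the lossy ladder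
    have hcf0 : ∀ e ∈ (M ＼ (Kc : Set α)).E, ¬ (M ＼ (Kc : Set α)).IsColoop e := by
      intro e _
      rw [hKset]
      exact not_isColoop_delete_coloops M e
    have hcol0 : (M ＼ (Kc : Set α)).coloops = ∅ := coloops_eq_empty_of_forall _ hcf0
    obtain ⟨c, hcκ, hcell⟩ := hcell Kc.card hge
    have hcell' := hcell (M ＼ (Kc : Set α)) hR0 hn0 hcol0 hfree0 (S1.pairs_of_free _ hfree0)
      (S1.lines_of_free _ hfree0) (S1.planes_of_free _ hfree0) (S1.tens_of_free _ hfree0)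
      (fun X hX h => ncard_le_nineteen_of_eRk_le_five_of_free _ hfree0 hX h)
    rw [hKset] at hcell'
    have hc : M.coloops.ncard = Kc.card := hKcard.symm
    have hpk : p - Kc.card + Kc.card = p := by omega
    have hmain := S2LP.phi_mul_topCount_le_of_delete_coloops M (p := p - Kc.card) (q := 7) (c := Kc.card)
      (by rw [hR', hpk]) (by omega) (by norm_num) hc (Φ := phiK p 7) (κ := c) hcκ hcell'
    rw [RLS_iff]
    rwa [hpk] at hmain

end ThmN

end PercRepro
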